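import Literature.AlgebraicGeometry.Resolution.Blowups
import Mathlib.AlgebraicGeometry.Morphisms.Finite
import Mathlib.AlgebraicGeometry.FunctionField
import HarnessLib

/-!
# The conductor bound for a finite modification: `I(U)ᴺ · Γ(X₃, g⁻¹U) ⊆ g^*Γ(X₂, U)` on each affine open
# (S-V1 of the FC′ r2 rung, affine part; crux `FInjectiveMacaulayfication` stmt-ResolutionOfSingularities-15315, chain w45a)

[OURS · L1 W4.5a · res-D-pv-019 AS res-L1-w45a-stub-7] Support file (`--supports stmt-ResolutionOfSingularities-15315
--as helper`) for the crux `FrobeniusLadder.FInjectiveMacaulayfication`; NOT a statement of any manuscript; no definitions,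
no named facts; AI-written (AI review is weaker than expert review). First half of the discharge of the typed input S-V1
`FiniteModificationOfBlowup.ConductorIdealExists` of res-L1-w45a-strat-1's `FCRungsSig.lean` v2.4 §B8 (uniform bound and
the conductor-type ideal sheaf in `…FiniteModificationConductorIdeal.lean`).

SETTING: `g : X₃ → X₂` affine (later finite and surjective, `X₃` integral), `U = Spec A ⊆ X₂` an affine open,
`g⁻¹U = Spec B`, `g^* = φ : A → B`, and an ideal sheaf `I` on `X₂` off whose support `g` is a stalk isomorphism.
All PROVED:

* `exists_pow_mul_eq_of_restrict_mem_range` (LOCALISING UP) — if `b|_{g⁻¹D(h)}` is in the image of `Γ(X₂, D(h))`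
  then `φ(hᴹ)·b ∈ φ(A)` for some `M` (`Γ(X₂, D(h)) = A[1/h]`, `Γ(X₃, g⁻¹D(h)) = B[1/φh]`);
* `mem_range_of_mem_map_of_forall_mem_range` (LOCALISING DOWN) — if `J ⊆ φ(A)` for an ideal `J ⊆ B` then
  `J·B[1/φh] ⊆ image of A[1/h]`;
* `exists_basicOpen_mul_eq_of_stalkMap_surjective` — LOCAL RATIONALITY: if `𝒪_{X₂,g x₃} → 𝒪_{X₃,x₃}` is onto
  (`X₃` integral) then every `b ∈ B` satisfies `φ(s)·b = φ(a)` for some `s` with `g x₃ ∈ D(s)`;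
* `mem_radical_of_forall_exists_basicOpen` — THE RADICAL LEMMA: if every point of `D(f)` lies in some `D(s)`, `s ∈ 𝔞`,
  then `f ∈ √𝔞` (primes of `A` are points of `U`);
* **`exists_pow_mul_le_range`** — THE CONDUCTOR BOUND ON AN AFFINE OPEN: for `g` finite surjective, `X₃` integral,
  `X₂` locally Noetherian, `∃ N, I(U)ᴺ·B ⊆ φ(A)` (`B/A` is a finitely generated `A`-module killed locally on
  `D(f)`, `f ∈ I(U)`, so `I(U) ⊆ √Ann(B/A)`).

Sources (method): the conductor of a finite birational extension is supported on the non-isomorphism locus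
(folklore; e.g. Stacks Project Tag 0C1N context); Görtz–Wedhorn I (13.19) for the blow-up setting. Nothing is cited as
a premise.
-/

-- single-problem summit: the doubled namespace component is forced
set_option linter.dupNamespace false

noncomputable section

open CategoryTheory CategoryTheory.Limits AlgebraicGeometry TopologicalSpace
open Literature.AlgebraicGeometry.Resolution

namespace Summit.ResolutionOfSingularities.ResolutionOfSingularities.Theorems.FInjectiveMacaulayfication.FiniteModificationConductor

universe u

variable {X₂ X₃ : Scheme.{u}} (g : X₃ ⟶ X₂)

/-! ## Localisation dictionary over a basic open `O = D(h) ⊆ U` of the base -/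

section Local

variable [IsAffineHom g]

/-- **Localising up.** Let `O = D(h) ⊆ U` (`U` affine, `h ∈ Γ(X₂, U)`). If the restriction of
`b ∈ Γ(X₃, g⁻¹U)` to `g⁻¹O` lies in the image of `g^* : Γ(X₂, O) → Γ(X₃, g⁻¹O)`, then
`g^*(h^M) · b` lies in the image of `Γ(X₂, U)` for some `M` (`Γ(X₂, O) = Γ(X₂, U)[1/h]`,
`Γ(X₃, g⁻¹O) = Γ(X₃, g⁻¹U)[1/g^*h]`). [folklore] -/
theorem exists_pow_mul_eq_of_restrict_mem_range (U : X₂.affineOpens) (h : Γ(X₂, U))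
    (O : X₂.Opens) (e : O = X₂.basicOpen h) (hle : g ⁻¹ᵁ O ≤ g ⁻¹ᵁ (U : X₂.Opens))
    (b : Γ(X₃, g ⁻¹ᵁ (U : X₂.Opens)))
    (hb : X₃.presheaf.map (homOfLE hle).op b ∈ Set.range (g.app O).hom) :
    ∃ (M : ℕ) (a : Γ(X₂, U)), (g.app U).hom (h ^ M) * b = (g.app U).hom a := by
  subst e
  have hV : IsAffineOpen (g ⁻¹ᵁ (U : X₂.Opens)) := U.2.preimage g
  -- the localisations `Γ(X₂, D(h)) = A[1/h]`, `Γ(X₃, g⁻¹D(h)) = B[1/g^*h]`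
  haveI hA : IsLocalization.Away h Γ(X₂, X₂.basicOpen h) := U.2.isLocalization_basicOpen h
  letI : Algebra Γ(X₃, g ⁻¹ᵁ (U : X₂.Opens)) Γ(X₃, g ⁻¹ᵁ X₂.basicOpen h) :=
    (X₃.presheaf.map (homOfLE hle).op).hom.toAlgebra
  have hB : IsLocalization.Away ((g.app U).hom h) Γ(X₃, g ⁻¹ᵁ X₂.basicOpen h) :=
    hV.isLocalization_of_eq_basicOpen ((g.app U).hom h) (homOfLE hle) (Scheme.preimage_basicOpen g h)
  have hρA : ∀ c, algebraMap Γ(X₂, U) Γ(X₂, X₂.basicOpen h) c =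
      (X₂.presheaf.map (homOfLE (X₂.basicOpen_le h)).op).hom c := fun _ => rfl
  have hρB : ∀ c, algebraMap Γ(X₃, g ⁻¹ᵁ (U : X₂.Opens)) Γ(X₃, g ⁻¹ᵁ X₂.basicOpen h) c =
      (X₃.presheaf.map (homOfLE hle).op).hom c := fun _ => rfl
  -- naturality: `g^*(c|_{D(h)}) = (g^* c)|_{g⁻¹D(h)}`
  have hnat : ∀ c : Γ(X₂, U), (g.app (X₂.basicOpen h)).hom
      ((X₂.presheaf.map (homOfLE (X₂.basicOpen_le h)).op).hom c) =
      (X₃.presheaf.map (homOfLE hle).op).hom ((g.app U).hom c) := by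
    intro c
    change (X₂.presheaf.map (homOfLE (X₂.basicOpen_le h)).op ≫ g.app (X₂.basicOpen h)).hom c =
      (g.app U ≫ X₃.presheaf.map (homOfLE hle).op).hom c
    rw [g.naturality]
    rfl
  obtain ⟨a', ha'⟩ := hb
  -- `a' = a / h^n`
  obtain ⟨⟨a, ⟨_, n, rfl⟩⟩, hsurj⟩ := IsLocalization.surj (Submonoid.powers h) a'
  simp only at hsurj
  -- so `b|·(g^* h^n)| = (g^* a)|` in `Γ(X₃, g⁻¹D(h))`
  have key : (X₃.presheaf.map (homOfLE hle).op).hom (b * (g.app U).hom (h ^ n) - (g.app U).hom a) = 0 := by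
    rw [map_sub, map_mul, ← hnat, ← hnat, ← hρA, ← hρA, ← hsurj, map_mul, ha']
    exact sub_self _
  rw [← hρB, IsLocalization.map_eq_zero_iff (Submonoid.powers ((g.app U).hom h))] at key
  obtain ⟨⟨_, m, rfl⟩, hm⟩ := key
  simp only at hm
  refine ⟨m + n, h ^ m * a, ?_⟩
  have : (g.app U).hom h ^ m * (b * (g.app U).hom (h ^ n) - (g.app U).hom a) = 0 := hm
  rw [mul_sub, sub_eq_zero] at this
  rw [pow_add, map_mul, map_mul, map_pow, ← this]
  ring

/-- **Localising down.** Let `O = D(h) ⊆ U` (`U` affine, `h ∈ Γ(X₂, U)`). If every element of an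
ideal `J ⊆ Γ(X₃, g⁻¹U)` lies in the image of `Γ(X₂, U)`, then every element of `J · Γ(X₃, g⁻¹O)`
lies in the image of `Γ(X₂, O)`. [folklore] -/
theorem mem_range_of_mem_map_of_forall_mem_range (U : X₂.affineOpens) (h : Γ(X₂, U))
    (O : X₂.Opens) (e : O = X₂.basicOpen h) (hOU : O ≤ (U : X₂.Opens))
    (hle : g ⁻¹ᵁ O ≤ g ⁻¹ᵁ (U : X₂.Opens)) (J : Ideal Γ(X₃, g ⁻¹ᵁ (U : X₂.Opens)))
    (hJ : ∀ c ∈ J, c ∈ Set.range (g.app U).hom) (z : Γ(X₃, g ⁻¹ᵁ O))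
    (hz : z ∈ J.map (X₃.presheaf.map (homOfLE hle).op).hom) :
    z ∈ Set.range (g.app O).hom := by
  subst e
  have hV : IsAffineOpen (g ⁻¹ᵁ (U : X₂.Opens)) := U.2.preimage g
  letI : Algebra Γ(X₃, g ⁻¹ᵁ (U : X₂.Opens)) Γ(X₃, g ⁻¹ᵁ X₂.basicOpen h) :=
    (X₃.presheaf.map (homOfLE hle).op).hom.toAlgebra
  have hB : IsLocalization.Away ((g.app U).hom h) Γ(X₃, g ⁻¹ᵁ X₂.basicOpen h) :=
    hV.isLocalization_of_eq_basicOpen ((g.app U).hom h) (homOfLE hle) (Scheme.preimage_basicOpen g h)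
  have hρB : ∀ c, algebraMap Γ(X₃, g ⁻¹ᵁ (U : X₂.Opens)) Γ(X₃, g ⁻¹ᵁ X₂.basicOpen h) c =
      (X₃.presheaf.map (homOfLE hle).op).hom c := fun _ => rfl
  have hnat : ∀ c : Γ(X₂, U), (g.app (X₂.basicOpen h)).hom
      ((X₂.presheaf.map (homOfLE hOU).op).hom c) =
      (X₃.presheaf.map (homOfLE hle).op).hom ((g.app U).hom c) := by
    intro c
    change (X₂.presheaf.map (homOfLE hOU).op ≫ g.app (X₂.basicOpen h)).hom c =
      (g.app U ≫ X₃.presheaf.map (homOfLE hle).op).hom c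
    rw [g.naturality]
    rfl
  -- `z = c / (g^* h)^e` with `c ∈ J`, `c = g^* a`
  obtain ⟨⟨⟨c, hc⟩, ⟨_, e, rfl⟩⟩, hz'⟩ :=
    (IsLocalization.mem_map_algebraMap_iff (Submonoid.powers ((g.app U).hom h)) _).mp hz
  simp only at hz'
  rw [hρB, hρB] at hz'
  obtain ⟨a, ha⟩ := hJ c hc
  -- `h|_{D(h)}` is a unit
  have hunit : IsUnit ((X₂.presheaf.map (homOfLE hOU).op).hom h) :=
    RingedSpace.isUnit_res_basicOpen (X := X₂.toRingedSpace) h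
  obtain ⟨u, hu⟩ := hunit.pow e
  refine ⟨(X₂.presheaf.map (homOfLE hOU).op).hom a * ↑u⁻¹, ?_⟩
  have h1 : z * (g.app (X₂.basicOpen h)).hom ((X₂.presheaf.map (homOfLE hOU).op).hom h) ^ e =
      (g.app (X₂.basicOpen h)).hom ((X₂.presheaf.map (homOfLE hOU).op).hom a) := by
    rw [hnat, hnat, ha, ← map_pow]
    exact hz'
  rw [map_mul, ← h1, ← map_pow, ← hu, mul_assoc, ← map_mul, Units.mul_inv, map_one, mul_one]

end Local

/-! ## Local rationality from a surjective stalk map; the radical lemma on an affine open -/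

section Pointwise

/-- **Local rationality from a surjective stalk map.** If `X₃` is integral and the stalk map
`𝒪_{X₂, g x₃} → 𝒪_{X₃, x₃}` is surjective, then every `b ∈ Γ(X₃, g⁻¹U)` (`U` affine, `g x₃ ∈ U`)
becomes a section of `X₂` after multiplication by some `g^* s` with `s` invertible at `g x₃`:
`g^*(s) · b = g^*(a)`. [folklore] -/
theorem exists_basicOpen_mul_eq_of_stalkMap_surjective [IsIntegral X₃] (U : X₂.affineOpens)
    (x₃ : X₃) (hx : g.base x₃ ∈ (U : X₂.Opens)) (hst : Function.Surjective (g.stalkMap x₃))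
    (b : Γ(X₃, g ⁻¹ᵁ (U : X₂.Opens))) :
    ∃ s a : Γ(X₂, U), g.base x₃ ∈ X₂.basicOpen s ∧ (g.app U).hom s * b = (g.app U).hom a := by
  have hx₃ : x₃ ∈ g ⁻¹ᵁ (U : X₂.Opens) := hx
  obtain ⟨t, ht⟩ := hst (X₃.presheaf.germ (g ⁻¹ᵁ (U : X₂.Opens)) x₃ hx₃ b)
  -- `t` is the germ of a section `t'` over an open `W ∋ g x₃`; shrink `W` to `D(s) ⊆ U ∩ W`
  obtain ⟨W, hxW, t', rfl⟩ := X₂.presheaf.exists_germ_eq t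
  obtain ⟨s, hsW, hxs⟩ := U.2.exists_basicOpen_le ⟨g.base x₃, hxW⟩ hx
  haveI := U.2.isLocalization_basicOpen s
  -- `t'|_{D(s)} = a / s^n`
  obtain ⟨⟨a, ⟨_, n, rfl⟩⟩, hsurj⟩ :=
    IsLocalization.surj (Submonoid.powers s) (X₂.presheaf.map (homOfLE hsW).op t')
  simp only at hsurj
  have hρ : ∀ c, algebraMap Γ(X₂, U) Γ(X₂, X₂.basicOpen s) c =
      (X₂.presheaf.map (homOfLE (X₂.basicOpen_le s)).op).hom c := fun _ => rfl
  rw [hρ, hρ] at hsurj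
  -- germs at `g x₃`: `t · [s^n] = [a]`
  have hgerm := congrArg (X₂.presheaf.germ (X₂.basicOpen s) (g.base x₃) hxs) hsurj
  rw [map_mul, TopCat.Presheaf.germ_res_apply, TopCat.Presheaf.germ_res_apply,
    TopCat.Presheaf.germ_res_apply] at hgerm
  -- apply the stalk map: `[b] · [g^* s^n] = [g^* a]` in `𝒪_{X₃, x₃}`
  have hstalk := congrArg (g.stalkMap x₃) hgerm
  rw [map_mul, ht, Scheme.Hom.germ_stalkMap_apply, Scheme.Hom.germ_stalkMap_apply, ← map_mul]
    at hstalk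
  refine ⟨s ^ n, a, ?_, ?_⟩
  · rw [X₂.mem_basicOpen (s ^ n) (g.base x₃) hx, map_pow]
    exact ((X₂.mem_basicOpen s (g.base x₃) hx).mp hxs).pow n
  · rw [mul_comm]
    exact germ_injective_of_isIntegral X₃ x₃ hx₃ hstalk

/-- **The radical lemma on an affine open.** If every point of `D(f) ⊆ U` lies in some `D(s)`,
`s ∈ 𝔞`, then `f ∈ √𝔞` (primes of `Γ(X₂, U)` are points of `U`). [folklore] -/
theorem mem_radical_of_forall_exists_basicOpen (U : X₂.affineOpens) (𝔞 : Ideal Γ(X₂, U))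
    (f : Γ(X₂, U)) (H : ∀ x : X₂, x ∈ X₂.basicOpen f → ∃ s ∈ 𝔞, x ∈ X₂.basicOpen s) :
    f ∈ 𝔞.radical := by
  rw [Ideal.radical_eq_sInf, Ideal.mem_sInf]
  rintro P ⟨hP𝔞, hP⟩
  by_contra hfP
  have hxf : U.2.fromSpec ⟨P, hP⟩ ∈ X₂.basicOpen f := by
    change (⟨P, hP⟩ : PrimeSpectrum Γ(X₂, U)) ∈ U.2.fromSpec ⁻¹ᵁ X₂.basicOpen f
    rw [U.2.fromSpec_preimage_basicOpen]
    exact hfP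
  obtain ⟨s, hs𝔞, hxs⟩ := H _ hxf
  have hs : (⟨P, hP⟩ : PrimeSpectrum Γ(X₂, U)) ∈ U.2.fromSpec ⁻¹ᵁ X₂.basicOpen s := hxs
  rw [U.2.fromSpec_preimage_basicOpen] at hs
  exact hs (hP𝔞 hs𝔞)

end Pointwise

/-! ## The conductor bound on one affine open -/

section Affine

/-- **The conductor bound on an affine open.** Let `g : X₃ → X₂` be finite and surjective with
`X₃` integral and `X₂` locally Noetherian, and a stalk isomorphism off the support of the ideal
sheaf `I`. Then on every affine open `U = Spec A` of `X₂` (`g⁻¹U = Spec B`) some power of `I(U)`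
multiplies `B` into `A`: `I(U)ᴺ · B ⊆ g^*(A)` — `B/A` is a finitely generated `A`-module supported
in `V(I(U))` (`exists_basicOpen_mul_eq_of_stalkMap_surjective` at the points of `D(f)`, `f ∈ I(U)`,
and `mem_radical_of_forall_exists_basicOpen`), so `I(U) ⊆ √Ann(B/A)`. [folklore: the conductor of a
finite birational extension is supported on the non-isomorphism locus] -/
theorem exists_pow_mul_le_range [IsIntegral X₃] [IsFinite g] [IsLocallyNoetherian X₂]
    (hsurj : Function.Surjective g.base) (I : X₂.IdealSheafData)
    (hiso : ∀ x₃ : X₃, g.base x₃ ∉ (I.support : Set X₂) → IsIso (g.stalkMap x₃))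
    (U : X₂.affineOpens) :
    ∃ N : ℕ, ∀ a ∈ I.ideal U ^ N, ∀ b : Γ(X₃, g ⁻¹ᵁ (U : X₂.Opens)),
      ∃ a' : Γ(X₂, U), (g.app U).hom a * b = (g.app U).hom a' := by
  classical
  -- the conductor `𝔣` and, for each `b`, the ideal `𝔞 b` of multipliers of `b` into `A`
  let 𝔞 : Γ(X₃, g ⁻¹ᵁ (U : X₂.Opens)) → Ideal Γ(X₂, U) := fun b =>
    { carrier := {a | ∃ a' : Γ(X₂, U), (g.app U).hom a * b = (g.app U).hom a'}
      add_mem' := by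
        rintro a₁ a₂ ⟨a₁', h₁⟩ ⟨a₂', h₂⟩
        exact ⟨a₁' + a₂', by rw [map_add, add_mul, h₁, h₂, map_add]⟩
      zero_mem' := ⟨0, by rw [map_zero, zero_mul]⟩
      smul_mem' := by
        rintro c a ⟨a', h⟩
        exact ⟨c * a', by rw [smul_eq_mul, map_mul, mul_assoc, h, map_mul]⟩ }
  have h𝔞 : ∀ b a, a ∈ 𝔞 b ↔ ∃ a' : Γ(X₂, U), (g.app U).hom a * b = (g.app U).hom a' :=
    fun _ _ => Iff.rfl
  -- step 1: every `f ∈ I(U)` lies in `√(𝔞 b)`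
  have step1 : ∀ b, ∀ f ∈ I.ideal U, f ∈ (𝔞 b).radical := by
    intro b f hf
    refine mem_radical_of_forall_exists_basicOpen U (𝔞 b) f fun x hxf => ?_
    have hxU : x ∈ (U : X₂.Opens) := X₂.basicOpen_le f hxf
    have hxI : x ∉ (I.support : Set X₂) := by
      intro h
      have h' : x ∈ I.support := h
      rw [Scheme.IdealSheafData.mem_support_iff_of_mem (I := I) (U := U) hxU,
        Scheme.mem_zeroLocus_iff] at h'
      exact h' f hf hxf
    obtain ⟨x₃, rfl⟩ := hsurj x
    haveI := hiso x₃ hxI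
    obtain ⟨s, a, hxs, hsa⟩ := exists_basicOpen_mul_eq_of_stalkMap_surjective g U x₃ hxU
      (ConcreteCategory.bijective_of_isIso (g.stalkMap x₃)).2 b
    exact ⟨s, (h𝔞 b s).mpr ⟨a, hsa⟩, hxs⟩
  -- step 2: `B` is a finitely generated `A`-module
  letI alg : Algebra Γ(X₂, U) Γ(X₃, g ⁻¹ᵁ (U : X₂.Opens)) := (g.app U).hom.toAlgebra
  haveI hfin : Module.Finite Γ(X₂, U) Γ(X₃, g ⁻¹ᵁ (U : X₂.Opens)) := IsFinite.finite_app g U U.2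
  obtain ⟨S, hS⟩ := Module.finite_def.mp hfin
  -- step 3: a uniform exponent for the generators gives `f^n ∈ 𝔣`
  have step3 : ∀ f ∈ I.ideal U, ∃ n : ℕ, ∀ b, f ^ n ∈ 𝔞 b := by
    intro f hf
    have hex : ∀ b : Γ(X₃, g ⁻¹ᵁ (U : X₂.Opens)), ∃ n : ℕ, f ^ n ∈ 𝔞 b := fun b => step1 b f hf
    choose n hn using hex
    refine ⟨S.sup n, fun b => ?_⟩
    -- membership of `f ^ (S.sup n)` in `𝔞 b` for all `b ∈ span S = ⊤`, by span induction
    have hgen : ∀ b' ∈ (S : Set Γ(X₃, g ⁻¹ᵁ (U : X₂.Opens))), f ^ S.sup n ∈ 𝔞 b' := by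
      intro b' hb'
      have hle : n b' ≤ S.sup n := Finset.le_sup (f := n) hb'
      rw [← Nat.sub_add_cancel hle, pow_add]
      exact Ideal.mul_mem_left _ _ (hn b')
    have hb : b ∈ Submodule.span Γ(X₂, U) (S : Set Γ(X₃, g ⁻¹ᵁ (U : X₂.Opens))) := by
      rw [hS]; trivial
    induction hb using Submodule.span_induction with
    | mem b' hb' => exact hgen b' hb'
    | zero => exact ⟨0, by rw [mul_zero, map_zero]⟩
    | add b₁ b₂ _ _ h₁ h₂ =>
      obtain ⟨a₁, h₁⟩ := h₁
      obtain ⟨a₂, h₂⟩ := h₂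
      exact ⟨a₁ + a₂, by rw [mul_add, h₁, h₂, map_add]⟩
    | smul c b' _ h =>
      obtain ⟨a', h⟩ := h
      refine ⟨c * a', ?_⟩
      rw [Algebra.smul_def, RingHom.algebraMap_toAlgebra, mul_left_comm, h, map_mul]
  -- step 4: `I(U)` is finitely generated, hence `I(U)^N ⊆ 𝔣`
  let 𝔣 : Ideal Γ(X₂, U) :=
    { carrier := {a | ∀ b, a ∈ 𝔞 b}
      add_mem' := fun h₁ h₂ b => Ideal.add_mem _ (h₁ b) (h₂ b)
      zero_mem' := fun b => Ideal.zero_mem _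
      smul_mem' := fun c _ h b => Ideal.mul_mem_left _ c (h b) }
  have hrad : I.ideal U ≤ 𝔣.radical := by
    intro f hf
    obtain ⟨n, hn⟩ := step3 f hf
    exact ⟨n, fun b => hn b⟩
  haveI : IsNoetherianRing Γ(X₂, U) := IsLocallyNoetherian.component_noetherian U
  obtain ⟨N, hN⟩ := Ideal.exists_pow_le_of_le_radical_of_fg hrad (IsNoetherian.noetherian _)
  exact ⟨N, fun a ha b => (h𝔞 b a).mp (hN ha b)⟩

end Affine


end Summit.ResolutionOfSingularities.ResolutionOfSingularities.Theorems.FInjectiveMacaulayfication.FiniteModificationConductor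

end
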